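import Summits.BirchSwinnertonDyer.BirchSwinnertonDyer.Theorems.ManinLocalTwoThreeEtaQuotientJacobiCharacter
import Summits.BirchSwinnertonDyer.BirchSwinnertonDyer.Theorems.ManinLocalTwoThreeThetaFourIntegerQSeries
import Literature.NumberTheory.EllipticCurves.WeightOneEtaQuotientsProofs
import Summits.BirchSwinnertonDyer.BirchSwinnertonDyer.Theorems.ManinLocalTwoThreeKummerCubeQExpansionPrinciple
import HarnessLib

/-!
# THE ANCHOR FORMS `g_t = η(τ)⁶η(tτ)²/(η(2τ)³η(2tτ)) = ϑ₄(2τ)³ϑ₄(2tτ)`: weight `2`, level `16t`, character `(t/·)`, integer `q`-expansion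
(route `ManinLocalTwoThree`, crux C2 `ManinOddAtFour` stmt-BirchSwinnertonDyer-22967; cell bsd-f2-manin, prover p3 gen 19; the anchors of the kernel port of
E-an-152d — one rational nowhere-vanishing holomorphic form, bounded at all cusps, for each Jacobi character `d ↦ (t/|d|)`)

For `t ≥ 1` let `r = 6·[δ=1] − 3·[δ=2] + 2·[δ=t] − [δ=2t]` on the divisors of `M = 16t`.  Newman's sums are `Σ r_δ = 4`, `Σ δ r_δ = 0`,
`Σ (M/δ) r_δ = 24(3t + 1)`, the Jacobi product is `∏ (δ/|d|)^{r_δ} = (t/|d|)` (`(2/|d|)⁴ = 1`), Ligozat's orders are `≥ 0` at every cusp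
(`96t − 24t·gcd(2,c)² + 32gcd(t,c)² − 8gcd(2t,c)² ≥ 0` as `gcd(2,c) ≤ 2`, `gcd(2t,c) ≤ 2gcd(t,c)`), and `g_t = ϑ₄(2τ)³ϑ₄(2tτ)` by the tree's
`ϑ₄(τ)η(τ) = η(τ/2)²`, so the `q`-expansion is INTEGRAL.
* `exists_thetaAnchor` — for every `t ≥ 1`: a holomorphic nowhere-vanishing `g : ℍ → ℂ`, bounded at every cusp, with
  `g ∣₂ γ = (t/|d_γ|)·g` for `γ ∈ Γ₀(16t)` and `Σ cₙ 𝕢τⁿ = g(τ)` on `ℍ` for some `c : ℕ → ℚ`.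
HONEST FRAMING: classical (Newman 1959, Ligozat 1975, Jacobi); nothing about Manin constants, C2 or BSD is proved here.  No definitions, no sorry.
[cite: Newman1959] [cite: Savitt2025, Thm. 1 and Rem. 2] [cite: WhittakerWatson1927, §21.42]
-/

set_option autoImplicit false
-- lint-debt: the directory name repeats the summit name (sibling precedent `ManinLocalTwoThreeEtaQuotientJacobiCharacter.lean`)
set_option linter.dupNamespace false

noncomputable section

open UpperHalfPlane hiding I
open ModularForm Complex Matrix.SpecialLinearGroup Filter Asymptotics CongruenceSubgroup PowerSeries
open scoped MatrixGroups Real ModularForm CongruenceSubgroup Topology Manifold NumberTheorySymbols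
open Literature.NumberTheory.EllipticCurves.ModularForms
open Literature.NumberTheory.EllipticCurves.JacobiThetaNull

namespace Summit.BirchSwinnertonDyer.BirchSwinnertonDyer.Theorems.ManinLocalTwoThree.EtaAnchor

/-- Sums against the indicator exponent vector `r = 6[δ=1] − 3[δ=2] + 2[δ=t] − [δ=2t]` over the divisors of `16t`. [folklore] -/
theorem sum_indicator_divisors (t : ℕ) (ht : 0 < t) (φ : ℕ → ℤ) :
    ∑ δ ∈ (16 * t).divisors, ((if δ = 1 then (6 : ℤ) else 0) + (if δ = 2 then -3 else 0) + (if δ = t then 2 else 0) +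
      (if δ = 2 * t then -1 else 0)) * φ δ = 6 * φ 1 - 3 * φ 2 + 2 * φ t - φ (2 * t) := by
  have hM : 16 * t ≠ 0 := by omega
  have h1 : 1 ∈ (16 * t).divisors := Nat.mem_divisors.mpr ⟨one_dvd _, hM⟩
  have h2 : 2 ∈ (16 * t).divisors := Nat.mem_divisors.mpr ⟨Dvd.dvd.mul_right (by norm_num) t, hM⟩
  have ht' : t ∈ (16 * t).divisors := Nat.mem_divisors.mpr ⟨Dvd.intro_left 16 rfl, hM⟩
  have h2t : 2 * t ∈ (16 * t).divisors := Nat.mem_divisors.mpr ⟨⟨8, by ring⟩, hM⟩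
  simp only [add_mul, ite_mul, zero_mul, Finset.sum_add_distrib, Finset.sum_ite_eq', h1, h2, ht', h2t, if_true]
  ring

/-- Products against the indicator exponent vector: `∏_δ x_δ^{r_δ} = x₁⁶ x₂⁻³ x_t² x_{2t}⁻¹` for nonvanishing `x`. [folklore] -/
theorem prod_indicator_divisors (t : ℕ) (ht : 0 < t) (x : ℕ → ℂ) (hx : ∀ δ ∈ (16 * t).divisors, x δ ≠ 0) :
    ∏ δ ∈ (16 * t).divisors, x δ ^ ((if δ = 1 then (6 : ℤ) else 0) + (if δ = 2 then -3 else 0) + (if δ = t then 2 else 0) +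
      (if δ = 2 * t then -1 else 0)) = x 1 ^ (6 : ℤ) * x 2 ^ (-3 : ℤ) * x t ^ (2 : ℤ) * x (2 * t) ^ (-1 : ℤ) := by
  have hM : 16 * t ≠ 0 := by omega
  have h1 : 1 ∈ (16 * t).divisors := Nat.mem_divisors.mpr ⟨one_dvd _, hM⟩
  have h2 : 2 ∈ (16 * t).divisors := Nat.mem_divisors.mpr ⟨Dvd.dvd.mul_right (by norm_num) t, hM⟩
  have ht' : t ∈ (16 * t).divisors := Nat.mem_divisors.mpr ⟨Dvd.intro_left 16 rfl, hM⟩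
  have h2t : 2 * t ∈ (16 * t).divisors := Nat.mem_divisors.mpr ⟨⟨8, by ring⟩, hM⟩
  rw [Finset.prod_congr rfl fun δ hδ ↦ by rw [zpow_add₀ (hx δ hδ), zpow_add₀ (hx δ hδ), zpow_add₀ (hx δ hδ)]]
  rw [Finset.prod_mul_distrib, Finset.prod_mul_distrib, Finset.prod_mul_distrib]
  have e : ∀ (d : ℕ) (c : ℤ), d ∈ (16 * t).divisors → ∏ δ ∈ (16 * t).divisors, x δ ^ (if δ = d then c else 0) = x d ^ c := by
    intro d c hd
    rw [← Finset.prod_erase_mul _ _ hd, if_pos rfl, Finset.prod_eq_one fun δ hδ ↦ by rw [if_neg (Finset.ne_of_mem_erase hδ), zpow_zero], one_mul]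
  rw [e 1 6 h1, e 2 (-3) h2, e t 2 ht', e (2 * t) (-1) h2t]

/-- **The anchor forms.**  For every `t ≥ 1` there are a holomorphic nowhere-vanishing `g : ℍ → ℂ` (namely `η(τ)⁶η(tτ)²/(η(2τ)³η(2tτ))
= ϑ₄(2τ)³ϑ₄(2tτ)`), bounded at every cusp, with `g ∣₂ γ = (t/|d_γ|)·g` for all `γ ∈ Γ₀(16t)`, and `c : ℕ → ℚ` with `Σ cₙ 𝕢τⁿ = g(τ)` on `ℍ`.
[cite: Newman1959] [cite: Savitt2025, Thm. 1 and Rem. 2] [cite: WhittakerWatson1927, §21.42] -/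
theorem exists_thetaAnchor (t : ℕ) (ht : 0 < t) :
    ∃ (g : ℍ → ℂ) (c : ℕ → ℚ), MDifferentiable 𝓘(ℂ) 𝓘(ℂ) g ∧ (∀ δ : SL(2, ℤ), IsBoundedAtImInfty (g ∣[(2 : ℤ)] δ)) ∧
      (∀ γ ∈ Gamma0 (16 * t), g ∣[(2 : ℤ)] γ = ((J((t : ℤ) | (γ 1 1).natAbs) : ℤ) : ℂ) • g) ∧
      (∀ τ : ℍ, HasSum (fun n : ℕ ↦ ((c n : ℚ) : ℂ) * Function.Periodic.qParam 1 (τ : ℂ) ^ n) (g τ)) ∧ (∀ τ : ℍ, g τ ≠ 0) := by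
  classical
  set M : ℕ := 16 * t with hMdef
  have hM : M ≠ 0 := by omega
  have hMpos : 0 < M := by omega
  have hMeven : Even M := ⟨8 * t, by omega⟩
  set r : ℕ → ℤ := fun δ ↦ (if δ = 1 then (6 : ℤ) else 0) + (if δ = 2 then -3 else 0) + (if δ = t then 2 else 0) +
    (if δ = 2 * t then -1 else 0) with hr
  -- Newman's sums
  have hk : ∑ δ ∈ M.divisors, r δ = 2 * 2 := by
    have h := sum_indicator_divisors t ht (fun _ ↦ 1)
    simp only [mul_one] at h
    rw [hMdef]; simpa using h
  have h1 : (24 : ℤ) ∣ ∑ δ ∈ M.divisors, (δ : ℤ) * r δ := by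
    have h := sum_indicator_divisors t ht (fun δ ↦ (δ : ℤ))
    rw [hMdef, Finset.sum_congr rfl fun (δ : ℕ) _ ↦ mul_comm ((δ : ℕ) : ℤ) (r δ)]
    rw [show (∑ δ ∈ (16 * t).divisors, r δ * (δ : ℤ)) = 6 * ((1 : ℕ) : ℤ) - 3 * ((2 : ℕ) : ℤ) + 2 * (t : ℤ) - ((2 * t : ℕ) : ℤ) from h]
    exact ⟨0, by push_cast; ring⟩
  have h2 : (24 : ℤ) ∣ ∑ δ ∈ M.divisors, ((M / δ : ℕ) : ℤ) * r δ := by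
    have h := sum_indicator_divisors t ht (fun δ ↦ ((M / δ : ℕ) : ℤ))
    rw [hMdef] at h ⊢
    rw [Finset.sum_congr rfl fun (δ : ℕ) _ ↦ mul_comm (((16 * t) / δ : ℕ) : ℤ) (r δ), h]
    have e1 : (16 * t) / 1 = 16 * t := Nat.div_one _
    have e2 : (16 * t) / 2 = 8 * t := by omega
    have et : (16 * t) / t = 16 := by rw [Nat.mul_div_cancel _ ht]
    have e2t : (16 * t) / (2 * t) = 8 := by rw [show 16 * t = 8 * (2 * t) by ring, Nat.mul_div_cancel _ (by omega)]
    rw [e1, e2, et, e2t]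
    exact ⟨3 * t + 1, by push_cast; ring⟩
  -- Ligozat's orders are non-negative at every cusp
  have hord : ∀ cc : ℤ, 0 ≤ cuspOrder24 M r cc := by
    intro cc
    rw [cuspOrder24, hMdef]
    have h := sum_indicator_divisors t ht (fun δ ↦ (Int.gcd δ cc : ℤ) ^ 2 * (((16 * t) / δ : ℕ) : ℤ))
    rw [Finset.sum_congr rfl fun (δ : ℕ) _ ↦ (mul_assoc (r δ) _ _), h]
    have e1 : (16 * t) / 1 = 16 * t := Nat.div_one _
    have e2 : (16 * t) / 2 = 8 * t := by omega
    have et : (16 * t) / t = 16 := by rw [Nat.mul_div_cancel _ ht]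
    have e2t : (16 * t) / (2 * t) = 8 := by rw [show 16 * t = 8 * (2 * t) by ring, Nat.mul_div_cancel _ (by omega)]
    rw [e1, e2, et, e2t]
    have hg1 : Int.gcd (1 : ℕ) cc = 1 := by simp [Int.gcd]
    rw [hg1]
    push_cast
    have hg2 : Int.gcd (2 : ℤ) cc ≤ 2 := Nat.le_of_dvd two_pos (by
      have := Int.gcd_dvd_left (2 : ℤ) cc
      exact_mod_cast this)
    have htpos : 0 < Int.gcd (t : ℤ) cc := Int.gcd_pos_of_ne_zero_left cc (by exact_mod_cast ht.ne')
    have hg2t : Int.gcd (2 * (t : ℤ)) cc ≤ 2 * Int.gcd (t : ℤ) cc := by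
      have hdvd : (Int.gcd (2 * (t : ℤ)) cc : ℤ) ∣ ((2 * Int.gcd (t : ℤ) cc : ℕ) : ℤ) := by
        have h1' : (Int.gcd (2 * (t : ℤ)) cc : ℤ) ∣ 2 * (t : ℤ) := Int.gcd_dvd_left _ cc
        have h2' : (Int.gcd (2 * (t : ℤ)) cc : ℤ) ∣ 2 * cc := (Int.gcd_dvd_right _ cc).mul_left 2
        have h3 : (Int.gcd (2 * (t : ℤ)) cc : ℤ) ∣ (Int.gcd (2 * (t : ℤ)) (2 * cc) : ℤ) := Int.dvd_coe_gcd h1' h2'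
        rw [Int.gcd_mul_left] at h3
        simpa using h3
      exact Nat.le_of_dvd (by positivity) (by exact_mod_cast hdvd)
    have ht1 : (1 : ℤ) ≤ t := by exact_mod_cast ht
    have hg2' : ((Int.gcd (2 : ℤ) cc : ℕ) : ℤ) ≤ 2 := by exact_mod_cast hg2
    have hg2t' : ((Int.gcd (2 * (t : ℤ)) cc : ℕ) : ℤ) ≤ 2 * ((Int.gcd (t : ℤ) cc : ℕ) : ℤ) := by exact_mod_cast hg2t
    have h0a : (0 : ℤ) ≤ ((Int.gcd (2 : ℤ) cc : ℕ) : ℤ) := Int.natCast_nonneg _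
    have h0b : (0 : ℤ) ≤ ((Int.gcd (2 * (t : ℤ)) cc : ℕ) : ℤ) := Int.natCast_nonneg _
    have hA : ((Int.gcd (2 : ℤ) cc : ℕ) : ℤ) ^ 2 ≤ 4 := by nlinarith
    have hB : ((Int.gcd (2 * (t : ℤ)) cc : ℕ) : ℤ) ^ 2 ≤ 4 * ((Int.gcd (t : ℤ) cc : ℕ) : ℤ) ^ 2 := by nlinarith
    nlinarith [hA, hB, ht1, sq_nonneg (((Int.gcd (t : ℤ) cc : ℕ) : ℤ))]
  -- the `q`-series of `ϑ₄(2τ)` and `ϑ₄(2tτ)`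
  obtain ⟨c₁, hc₁⟩ := exists_hasSum_theta4_two_mul 1 one_pos
  obtain ⟨c₂, hc₂⟩ := exists_hasSum_theta4_two_mul t ht
  set P₁ : ℂ⟦X⟧ := PowerSeries.mk fun n ↦ ((c₁ n : ℤ) : ℂ) with hP₁
  set P₂ : ℂ⟦X⟧ := PowerSeries.mk fun n ↦ ((c₂ n : ℤ) : ℂ) with hP₂
  set Q : ℚ⟦X⟧ := (PowerSeries.mk fun n ↦ ((c₁ n : ℤ) : ℚ)) ^ 3 * PowerSeries.mk fun n ↦ ((c₂ n : ℤ) : ℚ) with hQ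
  have hQmap : Q.map (algebraMap ℚ ℂ) = P₁ ^ 3 * P₂ := by
    have e1 : (PowerSeries.mk fun n ↦ ((c₁ n : ℤ) : ℚ)).map (algebraMap ℚ ℂ) = P₁ := by ext n; simp [hP₁, coeff_map]
    have e2 : (PowerSeries.mk fun n ↦ ((c₂ n : ℤ) : ℚ)).map (algebraMap ℚ ℂ) = P₂ := by ext n; simp [hP₂, coeff_map]
    rw [hQ, map_mul, map_pow, e1, e2]
  refine ⟨etaQuotient M r, fun n ↦ coeff n Q, mdifferentiable_etaQuotient M r, fun δ ↦ ?_, fun γ hγ ↦ ?_, fun τ ↦ ?_,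
    etaQuotient_ne_zero M r⟩
  · -- bounded at every cusp
    exact isBoundedAtImInfty_etaQuotient_slash M hMpos r 2 hk δ (hord _)
  · -- the character
    rw [etaQuotient_slash_jacobiProd M hMpos hMeven r 2 (by decide) hk h1 h2 hγ]
    congr 1
    set m : ℕ := (γ 1 1).natAbs with hm
    -- `d` is coprime to `M`, hence to every divisor
    have hMc : ((M : ℕ) : ℤ) ∣ γ 1 0 := by
      rw [Gamma0_mem] at hγ
      exact (ZMod.intCast_zmod_eq_zero_iff_dvd _ M).mp hγ
    have hcop : IsCoprime (γ 1 0) (γ 1 1) := by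
      refine ⟨γ 1 1 * 0 + -γ 0 1, γ 0 0, ?_⟩
      linear_combination det_entries γ
    have hδcop : ∀ δ ∈ M.divisors, Int.gcd (δ : ℤ) m = 1 := fun δ hδ ↦ by
      have h : IsCoprime (δ : ℤ) (γ 1 1) :=
        hcop.of_isCoprime_of_dvd_left ((Int.natCast_dvd_natCast.mpr (Nat.dvd_of_mem_divisors hδ)).trans hMc)
      have := Int.isCoprime_iff_gcd_eq_one.mp h
      simpa [Int.gcd, hm, Int.natAbs_abs] using this
    have hunit : ∀ δ ∈ M.divisors, ((J((δ : ℤ) | m) : ℤ) : ℂ) * ((J((δ : ℤ) | m) : ℤ) : ℂ) = 1 := fun δ hδ ↦ by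
      rcases jacobiSym.eq_one_or_neg_one (hδcop δ hδ) with h | h <;> rw [h] <;> norm_num
    have hne : ∀ δ ∈ M.divisors, ((J((δ : ℤ) | m) : ℤ) : ℂ) ≠ 0 := fun δ hδ h ↦ by
      have := hunit δ hδ; rw [h, zero_mul] at this; exact zero_ne_one this
    rw [hMdef] at hne hunit
    rw [hMdef, prod_indicator_divisors t ht (fun δ ↦ ((J((δ : ℤ) | m) : ℤ) : ℂ)) hne]
    have h1m : 1 ∈ (16 * t).divisors := Nat.mem_divisors.mpr ⟨one_dvd _, by omega⟩
    have h2m : 2 ∈ (16 * t).divisors := Nat.mem_divisors.mpr ⟨Dvd.dvd.mul_right (by norm_num) t, by omega⟩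
    have htm : t ∈ (16 * t).divisors := Nat.mem_divisors.mpr ⟨Dvd.intro_left 16 rfl, by omega⟩
    set u : ℂ := ((J((2 : ℤ) | m) : ℤ) : ℂ) with hu
    set v : ℂ := ((J((t : ℤ) | m) : ℤ) : ℂ) with hv
    have hu2 : u * u = 1 := by simpa using hunit 2 h2m
    have hv2 : v * v = 1 := by simpa using hunit t htm
    have hune : u ≠ 0 := by have h := hne 2 h2m; rw [hu]; exact_mod_cast h
    have hvne : v ≠ 0 := by have h := hne t htm; rw [hv]; exact_mod_cast h
    have hJ1 : ((J(((1 : ℕ) : ℤ) | m) : ℤ) : ℂ) = 1 := by rw [Nat.cast_one, jacobiSym.one_left]; simp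
    have hJ2 : ((J(((2 : ℕ) : ℤ) | m) : ℤ) : ℂ) = u := by rw [hu]; norm_cast
    have hJ2t : ((J(((2 * t : ℕ) : ℤ) | m) : ℤ) : ℂ) = u * v := by
      rw [hu, hv, show (((2 * t : ℕ) : ℤ)) = 2 * (t : ℤ) by push_cast; ring, jacobiSym.mul_left]; push_cast; ring
    rw [hJ1, hJ2, hJ2t, one_zpow, one_mul]
    show u ^ (-3 : ℤ) * v ^ (2 : ℤ) * (u * v) ^ (-1 : ℤ) = v
    have hui : u⁻¹ = u := inv_eq_of_mul_eq_one_right hu2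
    have hvi : v⁻¹ = v := inv_eq_of_mul_eq_one_right hv2
    rw [zpow_neg, zpow_neg, zpow_one, show (3 : ℤ) = ((3 : ℕ) : ℤ) from rfl, show (2 : ℤ) = ((2 : ℕ) : ℤ) from rfl, zpow_natCast,
      zpow_natCast, ← inv_pow, hui, mul_inv, hui, hvi]
    linear_combination (u ^ 2 + 1) * v ^ 3 * hu2 + v * hv2
  · -- the `q`-expansion: `η⁶η(t·)²/(η(2·)³η(2t·)) = ϑ₄(2τ)³ϑ₄(2tτ)`
    have hτ : 0 < (τ : ℂ).im := τ.im_pos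
    have hval : etaQuotient M r τ = theta4 (2 * ((1 : ℕ) : ℂ) * τ) ^ 3 * theta4 (2 * (t : ℂ) * τ) := by
      rw [etaQuotient_apply, hMdef, prod_indicator_divisors t ht (fun δ ↦ η (δ * (τ : ℂ))) (fun δ hδ ↦
        eta_natMul_ne_zero (Nat.pos_of_mem_divisors hδ) hτ)]
      have hθ1 : theta4 (2 * ((1 : ℕ) : ℂ) * τ) = η (τ : ℂ) ^ 2 * (η (2 * (τ : ℂ)))⁻¹ := by
        have h := Literature.Analysis.SpecialFunctions.theta4_mul_eta (τ := 2 * (τ : ℂ)) (by simpa using mul_pos two_pos hτ)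
        rw [show 2 * (τ : ℂ) / 2 = τ by ring] at h
        have hne2 : η (2 * (τ : ℂ)) ≠ 0 := by simpa using eta_natMul_ne_zero (δ := 2) two_pos hτ
        rw [Nat.cast_one, mul_one, eq_mul_inv_iff_mul_eq₀ hne2, h]
      have hθt : theta4 (2 * (t : ℂ) * τ) = η ((t : ℂ) * τ) ^ 2 * (η (2 * (t : ℂ) * τ))⁻¹ := by
        have htτ : 0 < ((t : ℂ) * τ).im := by simpa using mul_pos (Nat.cast_pos.mpr ht) hτ
        have h := Literature.Analysis.SpecialFunctions.theta4_mul_eta (τ := 2 * ((t : ℂ) * τ)) (by simpa using mul_pos two_pos htτ)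
        rw [show 2 * ((t : ℂ) * τ) / 2 = (t : ℂ) * τ by ring, ← mul_assoc] at h
        have hne2 : η (2 * (t : ℂ) * τ) ≠ 0 := by
          have := eta_natMul_ne_zero (δ := 2 * t) (by omega) hτ
          simpa [mul_assoc] using this
        rw [eq_mul_inv_iff_mul_eq₀ hne2, h]
      rw [hθ1, hθt]
      simp only [Nat.cast_one, one_mul, Nat.cast_mul, Nat.cast_ofNat]
      rw [zpow_neg, zpow_neg, zpow_one, show (6 : ℤ) = ((6 : ℕ) : ℤ) from rfl, show (3 : ℤ) = ((3 : ℕ) : ℤ) from rfl,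
        show (2 : ℤ) = ((2 : ℕ) : ℤ) from rfl, zpow_natCast, zpow_natCast, zpow_natCast]
      ring
    rw [hval]
    have hs₁ : HasSum (fun n : ℕ ↦ coeff n P₁ * Function.Periodic.qParam 1 (τ : ℂ) ^ n) (theta4 (2 * ((1 : ℕ) : ℂ) * τ)) := by
      convert hc₁ τ using 2 with n; rw [hP₁, coeff_mk]
    have hs₂ : HasSum (fun n : ℕ ↦ coeff n P₂ * Function.Periodic.qParam 1 (τ : ℂ) ^ n) (theta4 (2 * (t : ℂ) * τ)) := by
      convert hc₂ τ using 2 with n; rw [hP₂, coeff_mk]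
    have h3 := KummerCubeSigmaLeaves.hasSum_coeff_mul_pow_mul (KummerCubeSigmaLeaves.hasSum_coeff_mul_pow_mul hs₁ hs₁) hs₁
    have h4 := KummerCubeSigmaLeaves.hasSum_coeff_mul_pow_mul h3 hs₂
    convert h4 using 2 with n
    · rw [show P₁ * P₁ * P₁ * P₂ = P₁ ^ 3 * P₂ by ring, ← hQmap, coeff_map]; rfl
    · ring

end Summit.BirchSwinnertonDyer.BirchSwinnertonDyer.Theorems.ManinLocalTwoThree.EtaAnchor

end
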